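import Mathlib.NumberTheory.Harmonic.EulerMascheroni
import Mathlib.Analysis.SpecialFunctions.Log.Deriv
import Mathlib.Analysis.SpecificLimits.Basic
import Literature.Analysis.SpecialFunctions.LogTwoBounds
import Literature.Analysis.SpecialFunctions.EulerMascheroniBounds
import HarnessLib

/-!
# Euler's constant to `8·10⁻¹⁵`: `0.5772156649015328 < γ < 0.5772156649015405`

Topic: `Literature/Analysis/SpecialFunctions`. The companion file `EulerMascheroniBounds.lean`
proves the second-order enclosure `0.57721558 < γ < 0.57721571` from the sequences
`H_n − log n − 1/(2n) ↑ γ`, `H_n − log(n + ½) ↓ γ` at `n = 1024` (rate `1/n²`). Certified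
numerics in Weil-type explicit formulae need `γ` to about `10⁻¹⁴`; this file PROVES the classical
**fourth-order Euler–Maclaurin pair**

* `U_n = H_n − log n − 1/(2n) + 1/(12n²)` decreases to `γ` for `n ≥ 1`
  (`harmonic_sub_log_fourth_order_upper_succ_le`, `tendsto_harmonic_sub_log_fourth_order_upper`,
  `le_harmonic_sub_log_fourth_order : γ ≤ U_n`);
* `L_n = U_n − 1/(120n⁴)` increases to `γ` for `n ≥ 1`
  (`harmonic_sub_log_fourth_order_lower_le_succ`, `tendsto_harmonic_sub_log_fourth_order_lower`,
  `harmonic_sub_log_fourth_order_le : L_n ≤ γ`);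

(recall `H_n − log n − γ ~ 1/(2n) − 1/(12n²) + 1/(120n⁴) − 1/(252n⁶) + …`, so
`U_n − γ ≈ 1/(120n⁴)` and `γ − L_n ≈ 1/(252n⁶)`), and the resulting enclosure at `n = 1024`:

* `eulerMascheroniConstant_gt_d16 : 0.5772156649015328 < γ`,
  `eulerMascheroniConstant_lt_d16 : γ < 0.5772156649015405`
  (true value `γ = 0.57721566490153286060…`; `U₁₀₂₄ = γ + 7.58·10⁻¹⁵`, `L₁₀₂₄ = γ − 3.4·10⁻²¹`;
  `H₁₀₂₄` to `10⁻²²` by kernel evaluation in `ℚ`, `log 1024 = 10 log 2` from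
  `LogTwoBounds.lean`).

Method. With `r = 1/(2n+1)` one has `1/n = 2r/(1−r)`, `1/(n+1) = 2r/(1+r)` and Mathlib's series
`log(1 + 1/n) = 2 ∑ r^{2k+1}/(2k+1)` (`Real.hasSum_log_one_add_inv`). The increments are
`U_{n+1} − U_n = 2r/(1−r²) − 4r³/(3(1−r²)²) − log(1 + 1/n)` and
`L_{n+1} − L_n = U_{n+1} − U_n + (16/15)·r⁵(1+r²)/(1−r²)⁴`; three terms of the series from below
give `U_{n+1} − U_n ≤ −r⁵(16/15 − (2/15)r² + (2/5)r⁴)/(1−r²)² ≤ 0`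
(`log_one_add_inv_ge_three_terms`, `fourth_order_upper_step`), and four terms plus the geometric
tail `(2/9)·r⁹/(1−r²)` from above give
`L_{n+1} − L_n ≥ r⁷(64/21 − (256/315)r² − (4/35)r⁴ + (8/105)r⁶ − (4/63)r⁸)/(1−r²)⁴ ≥ 0`
(`log_one_add_inv_le_four_terms`, `fourth_order_lower_step`). Both steps are proved as exact
rational-function identities in `x = n` with manifestly positive numerators.

What is NOT here: the full Euler–Maclaurin expansion with Bernoulli numbers / a remainder estimate
of general order (only the orders `2` and `4` needed for the numerics are proved, by hand).

## References

* (method) Euler–Maclaurin summation, NIST DLMF §2.10(i); the value of `γ` and the asymptotic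
  series `H_n − log n ~ γ + 1/(2n) − ∑ B_{2k}/(2k·n^{2k})`, NIST DLMF §5.2(ii), §5.11(i);
  Mathlib `Mathlib/NumberTheory/Harmonic/EulerMascheroni.lean` (`Real.tendsto_harmonic_sub_log`),
  `Mathlib/Analysis/SpecialFunctions/Log/Deriv.lean` (`Real.hasSum_log_one_add_inv`).
-/
noncomputable section

open Filter Topology Finset Real

namespace Literature.Analysis.SpecialFunctions.Real

/-! ### Three and four terms of the series for `log(1 + 1/a)` in powers of `r = 1/(2a+1)` -/

/-- `log(1 + 1/a) ≥ 2r + (2/3)r³ + (2/5)r⁵`, `r = 1/(2a+1)` (`a > 0`): the first three terms of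
Mathlib's series `Real.hasSum_log_one_add_inv`, all of whose terms are non-negative. [folklore] -/
theorem log_one_add_inv_ge_three_terms {a : ℝ} (ha : 0 < a) :
    2 * (1 / (2 * a + 1)) + 2 / 3 * (1 / (2 * a + 1)) ^ 3 + 2 / 5 * (1 / (2 * a + 1)) ^ 5
      ≤ Real.log (1 + a⁻¹) := by
  have h := sum_le_hasSum (Finset.range 3) (fun k _ => by positivity)
    (Real.hasSum_log_one_add_inv ha)
  have e : 2 * (1 / (2 * a + 1)) + 2 / 3 * (1 / (2 * a + 1)) ^ 3 + 2 / 5 * (1 / (2 * a + 1)) ^ 5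
      = ∑ i ∈ Finset.range 3,
          (2 : ℝ) * (1 / (2 * (i : ℝ) + 1)) * (1 / (2 * a + 1)) ^ (2 * i + 1) := by
    simp only [Finset.sum_range_succ, Finset.sum_range_zero]
    push_cast
    ring
  exact e.le.trans h

/-- `log(1 + 1/a) ≤ 2r + (2/3)r³ + (2/5)r⁵ + (2/7)r⁷ + (2/9)·r⁹/(1 − r²)`, `r = 1/(2a+1)`, where
`(2/9)·r⁹/(1 − r²) = 1/(18a(a+1)(2a+1)⁷)` (`a > 0`): four terms of the series, the terms `k ≥ 4`
bounded by `(2/9) r^{2k+1}` and summed geometrically. [folklore] -/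
theorem log_one_add_inv_le_four_terms {a : ℝ} (ha : 0 < a) :
    Real.log (1 + a⁻¹) ≤ 2 * (1 / (2 * a + 1)) + 2 / 3 * (1 / (2 * a + 1)) ^ 3
      + 2 / 5 * (1 / (2 * a + 1)) ^ 5 + 2 / 7 * (1 / (2 * a + 1)) ^ 7
      + 1 / (18 * a * (a + 1) * (2 * a + 1) ^ 7) := by
  set r : ℝ := 1 / (2 * a + 1) with hr
  have hr0 : 0 < r := by rw [hr]; positivity
  have hr1 : r < 1 := by rw [hr, div_lt_one (by positivity)]; linarith
  have hr2 : r ^ 2 < 1 := by nlinarith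
  have h := Real.hasSum_log_one_add_inv ha
  rw [← hr] at h
  -- the tail `k ≥ 4` against the geometric series `(2/9) r⁹ ∑ (r²)^k`
  have ht := (hasSum_nat_add_iff' 4).mpr h
  have hgeom : HasSum (fun k : ℕ => 2 / 9 * r ^ 9 * (r ^ 2) ^ k) (2 / 9 * r ^ 9 * (1 - r ^ 2)⁻¹) :=
    (hasSum_geometric_of_lt_one (by positivity) hr2).mul_left _
  have hle : ∀ k : ℕ, (2 : ℝ) * (1 / (2 * ((k + 4 : ℕ) : ℝ) + 1)) * r ^ (2 * (k + 4) + 1)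
      ≤ 2 / 9 * r ^ 9 * (r ^ 2) ^ k := by
    intro k
    have hk : (1 : ℝ) / (2 * ((k + 4 : ℕ) : ℝ) + 1) ≤ 1 / 9 :=
      one_div_le_one_div_of_le (by norm_num) (by push_cast; linarith [k.cast_nonneg (α := ℝ)])
    have hp : r ^ (2 * (k + 4) + 1) = r ^ 9 * (r ^ 2) ^ k := by ring
    have h0 : 0 ≤ r ^ 9 * (r ^ 2) ^ k := by positivity
    rw [hp]
    nlinarith [mul_le_mul_of_nonneg_right hk h0]
  have htail := hasSum_le hle ht hgeom
  have hS : ∑ i ∈ Finset.range 4, (2 : ℝ) * (1 / (2 * (i : ℝ) + 1)) * r ^ (2 * i + 1)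
      = 2 * r + 2 / 3 * r ^ 3 + 2 / 5 * r ^ 5 + 2 / 7 * r ^ 7 := by
    simp only [Finset.sum_range_succ, Finset.sum_range_zero]
    push_cast
    ring
  have e1 : (1 : ℝ) - r ^ 2 = 4 * a * (a + 1) / (2 * a + 1) ^ 2 := by
    rw [hr]; field_simp; ring
  have e : (2 : ℝ) / 9 * r ^ 9 * (1 - r ^ 2)⁻¹ = 1 / (18 * a * (a + 1) * (2 * a + 1) ^ 7) := by
    rw [e1, hr]; field_simp; ring
  rw [hS] at htail
  linarith [htail, e]

/-! ### One step of each sequence, as a rational-function inequality in `x > 0` -/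

/-- Upper step: for `x > 0`,
`1/(x+1) − log(1 + 1/x) + (1/(2x) − 1/(2(x+1))) − (1/(12x²) − 1/(12(x+1)²)) ≤ 0`, i.e.
`U(x+1) ≤ U(x)` for `U(x) = H − log x − 1/(2x) + 1/(12x²)`. After the three-term lower bound for
the logarithm the left side is exactly `−(16x²(x+1)² + 15(2x+1)⁴ + 5)/(240x²(x+1)²(2x+1)⁵)`.
[folklore] -/
theorem fourth_order_upper_step {x : ℝ} (hx : 0 < x) :
    (x + 1)⁻¹ - Real.log (1 + x⁻¹) + (1 / (2 * x) - 1 / (2 * (x + 1)))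
      - (1 / (12 * x ^ 2) - 1 / (12 * (x + 1) ^ 2)) ≤ 0 := by
  have hlog := log_one_add_inv_ge_three_terms hx
  have key : (x + 1)⁻¹ + (1 / (2 * x) - 1 / (2 * (x + 1)))
      - (1 / (12 * x ^ 2) - 1 / (12 * (x + 1) ^ 2))
      - (2 * (1 / (2 * x + 1)) + 2 / 3 * (1 / (2 * x + 1)) ^ 3 + 2 / 5 * (1 / (2 * x + 1)) ^ 5)
      = -((16 * x ^ 2 * (x + 1) ^ 2 + 15 * (2 * x + 1) ^ 4 + 5)
          / (240 * x ^ 2 * (x + 1) ^ 2 * (2 * x + 1) ^ 5)) := by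
    field_simp
    ring
  have hpos : 0 < (16 * x ^ 2 * (x + 1) ^ 2 + 15 * (2 * x + 1) ^ 4 + 5)
      / (240 * x ^ 2 * (x + 1) ^ 2 * (2 * x + 1) ^ 5) := by positivity
  linarith

/-- Lower step: for `x > 0`, `0 ≤ 1/(x+1) − log(1 + 1/x) + (1/(2x) − 1/(2(x+1)))
− (1/(12x²) − 1/(12(x+1)²)) + (1/(120x⁴) − 1/(120(x+1)⁴))`, i.e. `L(x) ≤ L(x+1)` for
`L(x) = U(x) − 1/(120x⁴)`. After the four-terms-plus-tail upper bound for the logarithm the right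
side is exactly `(240t⁴ + 896t³ + 1239t² + 756t + 168)/(20160x⁴(x+1)⁴(2x+1)⁷)`, `t = 4x(x+1)`.
[folklore] -/
theorem fourth_order_lower_step {x : ℝ} (hx : 0 < x) :
    0 ≤ (x + 1)⁻¹ - Real.log (1 + x⁻¹) + (1 / (2 * x) - 1 / (2 * (x + 1)))
      - (1 / (12 * x ^ 2) - 1 / (12 * (x + 1) ^ 2))
      + (1 / (120 * x ^ 4) - 1 / (120 * (x + 1) ^ 4)) := by
  have hlog := log_one_add_inv_le_four_terms hx
  have key : (x + 1)⁻¹ + (1 / (2 * x) - 1 / (2 * (x + 1)))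
      - (1 / (12 * x ^ 2) - 1 / (12 * (x + 1) ^ 2))
      + (1 / (120 * x ^ 4) - 1 / (120 * (x + 1) ^ 4))
      - (2 * (1 / (2 * x + 1)) + 2 / 3 * (1 / (2 * x + 1)) ^ 3 + 2 / 5 * (1 / (2 * x + 1)) ^ 5
        + 2 / 7 * (1 / (2 * x + 1)) ^ 7 + 1 / (18 * x * (x + 1) * (2 * x + 1) ^ 7))
      = (240 * (4 * x * (x + 1)) ^ 4 + 896 * (4 * x * (x + 1)) ^ 3
          + 1239 * (4 * x * (x + 1)) ^ 2 + 756 * (4 * x * (x + 1)) + 168)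
          / (20160 * x ^ 4 * (x + 1) ^ 4 * (2 * x + 1) ^ 7) := by
    field_simp
    ring
  have hpos : 0 ≤ (240 * (4 * x * (x + 1)) ^ 4 + 896 * (4 * x * (x + 1)) ^ 3
      + 1239 * (4 * x * (x + 1)) ^ 2 + 756 * (4 * x * (x + 1)) + 168)
      / (20160 * x ^ 4 * (x + 1) ^ 4 * (2 * x + 1) ^ 7) := by positivity
  linarith

/-! ### The sequences `U_n = H_n − log n − 1/(2n) + 1/(12n²) ↓ γ`, `L_n = U_n − 1/(120n⁴) ↑ γ` -/

/-- `U_{n+1} ≤ U_n` for `n ≥ 1`, `U_n = H_n − log n − 1/(2n) + 1/(12n²)`. [folklore] -/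
theorem harmonic_sub_log_fourth_order_upper_succ_le (n : ℕ) (hn : 1 ≤ n) :
    (harmonic (n + 1) : ℝ) - Real.log ((n + 1 : ℕ) : ℝ) - 1 / (2 * ((n + 1 : ℕ) : ℝ))
        + 1 / (12 * ((n + 1 : ℕ) : ℝ) ^ 2)
      ≤ (harmonic n : ℝ) - Real.log n - 1 / (2 * n) + 1 / (12 * n ^ 2) := by
  have hx : (0 : ℝ) < n := by exact_mod_cast hn
  have h := fourth_order_upper_step hx
  have hlog : Real.log ((n : ℝ) + 1) = Real.log n + Real.log (1 + (n : ℝ)⁻¹) := by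
    rw [← Real.log_mul hx.ne' (by positivity)]
    congr 1; field_simp
  rw [harmonic_succ_real]
  push_cast
  rw [hlog]
  linarith

/-- `L_n ≤ L_{n+1}` for `n ≥ 1`, `L_n = H_n − log n − 1/(2n) + 1/(12n²) − 1/(120n⁴)`.
[folklore] -/
theorem harmonic_sub_log_fourth_order_lower_le_succ (n : ℕ) (hn : 1 ≤ n) :
    (harmonic n : ℝ) - Real.log n - 1 / (2 * n) + 1 / (12 * n ^ 2) - 1 / (120 * n ^ 4)
      ≤ (harmonic (n + 1) : ℝ) - Real.log ((n + 1 : ℕ) : ℝ) - 1 / (2 * ((n + 1 : ℕ) : ℝ))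
        + 1 / (12 * ((n + 1 : ℕ) : ℝ) ^ 2) - 1 / (120 * ((n + 1 : ℕ) : ℝ) ^ 4) := by
  have hx : (0 : ℝ) < n := by exact_mod_cast hn
  have h := fourth_order_lower_step hx
  have hlog : Real.log ((n : ℝ) + 1) = Real.log n + Real.log (1 + (n : ℝ)⁻¹) := by
    rw [← Real.log_mul hx.ne' (by positivity)]
    congr 1; field_simp
  rw [harmonic_succ_real]
  push_cast
  rw [hlog]
  linarith

/-- Auxiliary: `1/(c·n^k) → 0` as `n → ∞`, for `k ≠ 0`. [folklore] -/
theorem tendsto_one_div_const_mul_pow (c : ℝ) {k : ℕ} (hk : k ≠ 0) :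
    Tendsto (fun n : ℕ => 1 / (c * (n : ℝ) ^ k)) atTop (𝓝 0) := by
  have h := ((tendsto_inv_atTop_nhds_zero_nat (𝕜 := ℝ)).pow k).const_mul c⁻¹
  rw [zero_pow hk, mul_zero] at h
  refine h.congr fun n => ?_
  rw [one_div, mul_inv, inv_pow]

/-- `U_n = H_n − log n − 1/(2n) + 1/(12n²) → γ`. [folklore] -/
theorem tendsto_harmonic_sub_log_fourth_order_upper :
    Tendsto (fun n : ℕ => (harmonic n : ℝ) - Real.log n - 1 / (2 * n) + 1 / (12 * n ^ 2)) atTop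
      (𝓝 Real.eulerMascheroniConstant) := by
  have h1 := tendsto_one_div_const_mul_pow (2 : ℝ) one_ne_zero
  simp only [pow_one] at h1
  have h := (Real.tendsto_harmonic_sub_log.sub h1).add
    (tendsto_one_div_const_mul_pow (12 : ℝ) two_ne_zero)
  rwa [sub_zero, add_zero] at h

/-- `L_n = H_n − log n − 1/(2n) + 1/(12n²) − 1/(120n⁴) → γ`. [folklore] -/
theorem tendsto_harmonic_sub_log_fourth_order_lower :
    Tendsto (fun n : ℕ => (harmonic n : ℝ) - Real.log n - 1 / (2 * n) + 1 / (12 * n ^ 2)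
      - 1 / (120 * n ^ 4)) atTop (𝓝 Real.eulerMascheroniConstant) := by
  have h := tendsto_harmonic_sub_log_fourth_order_upper.sub
    (tendsto_one_div_const_mul_pow (120 : ℝ) (k := 4) (by norm_num))
  rwa [sub_zero] at h

/-- **`γ ≤ H_n − log n − 1/(2n) + 1/(12n²)`** for `n ≥ 1` (the error is `≈ 1/(120n⁴)`).
[folklore] -/
theorem le_harmonic_sub_log_fourth_order (n : ℕ) (hn : 1 ≤ n) :
    Real.eulerMascheroniConstant
      ≤ (harmonic n : ℝ) - Real.log n - 1 / (2 * n) + 1 / (12 * n ^ 2) := by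
  have hmono : ∀ m, n ≤ m → (harmonic m : ℝ) - Real.log m - 1 / (2 * m) + 1 / (12 * m ^ 2)
      ≤ (harmonic n : ℝ) - Real.log n - 1 / (2 * n) + 1 / (12 * n ^ 2) := by
    intro m hm
    induction m, hm using Nat.le_induction with
    | base => exact le_rfl
    | succ m hm ih =>
      exact (harmonic_sub_log_fourth_order_upper_succ_le m (le_trans hn hm)).trans ih
  exact le_of_tendsto tendsto_harmonic_sub_log_fourth_order_upper (eventually_atTop.2 ⟨n, hmono⟩)

/-- **`H_n − log n − 1/(2n) + 1/(12n²) − 1/(120n⁴) ≤ γ`** for `n ≥ 1` (the error is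
`≈ 1/(252n⁶)`). [folklore] -/
theorem harmonic_sub_log_fourth_order_le (n : ℕ) (hn : 1 ≤ n) :
    (harmonic n : ℝ) - Real.log n - 1 / (2 * n) + 1 / (12 * n ^ 2) - 1 / (120 * n ^ 4)
      ≤ Real.eulerMascheroniConstant := by
  have hmono : ∀ m, n ≤ m → (harmonic n : ℝ) - Real.log n - 1 / (2 * n) + 1 / (12 * n ^ 2)
      - 1 / (120 * n ^ 4)
      ≤ (harmonic m : ℝ) - Real.log m - 1 / (2 * m) + 1 / (12 * m ^ 2) - 1 / (120 * m ^ 4) := by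
    intro m hm
    induction m, hm using Nat.le_induction with
    | base => exact le_rfl
    | succ m hm ih =>
      exact ih.trans (harmonic_sub_log_fourth_order_lower_le_succ m (le_trans hn hm))
  exact ge_of_tendsto tendsto_harmonic_sub_log_fourth_order_lower (eventually_atTop.2 ⟨n, hmono⟩)

/-! ### Numerics at `n = 1024` -/

/-- `H₁₀₂₄ > 7.5091756722781338333770` (kernel evaluation in `ℚ`). [folklore] -/
theorem harmonic_1024_gt_d22 :
    (75091756722781338333770 / 10000000000000000000000 : ℚ) < harmonic 1024 := by decide +kernel

/-- `H₁₀₂₄ < 7.5091756722781338333771` (kernel evaluation in `ℚ`). [folklore] -/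
theorem harmonic_1024_lt_d22 :
    harmonic 1024 < (75091756722781338333771 / 10000000000000000000000 : ℚ) := by decide +kernel

/-- **`γ > 0.5772156649015328`** (true value `0.57721566490153286060…`; from `L₁₀₂₄ ≤ γ` with
`log 1024 = 10 log 2`). [folklore] -/
theorem eulerMascheroniConstant_gt_d16 :
    (0.5772156649015328 : ℝ) < Real.eulerMascheroniConstant := by
  have h := harmonic_sub_log_fourth_order_le 1024 (by norm_num)
  have hH : ((75091756722781338333770 / 10000000000000000000000 : ℚ) : ℝ)
      < ((harmonic 1024 : ℚ) : ℝ) := Rat.cast_lt.2 harmonic_1024_gt_d22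
  have hlog : Real.log ((1024 : ℕ) : ℝ) = 10 * Real.log 2 := by
    rw [show ((1024 : ℕ) : ℝ) = 2 ^ 10 by norm_num, Real.log_pow]; norm_num
  have h2 := log_two_lt_d20
  have e1 : (1 : ℝ) / (2 * ((1024 : ℕ) : ℝ)) = 1 / 2048 := by norm_num
  have e2 : (1 : ℝ) / (12 * ((1024 : ℕ) : ℝ) ^ 2) = 1 / 12582912 := by norm_num
  have e4 : (1 : ℝ) / (120 * ((1024 : ℕ) : ℝ) ^ 4) = 1 / 131941395333120 := by norm_num
  rw [hlog, e1, e2, e4] at h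
  generalize ((harmonic 1024 : ℚ) : ℝ) = H at h hH
  push_cast at hH
  linarith

/-- **`γ < 0.5772156649015405`** (from `γ ≤ U₁₀₂₄ = γ + 7.58·10⁻¹⁵`). [folklore] -/
theorem eulerMascheroniConstant_lt_d16 : Real.eulerMascheroniConstant < 0.5772156649015405 := by
  have h := le_harmonic_sub_log_fourth_order 1024 (by norm_num)
  have hH : ((harmonic 1024 : ℚ) : ℝ)
      < ((75091756722781338333771 / 10000000000000000000000 : ℚ) : ℝ) :=
    Rat.cast_lt.2 harmonic_1024_lt_d22
  have hlog : Real.log ((1024 : ℕ) : ℝ) = 10 * Real.log 2 := by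
    rw [show ((1024 : ℕ) : ℝ) = 2 ^ 10 by norm_num, Real.log_pow]; norm_num
  have h2 := log_two_gt_d20
  have e1 : (1 : ℝ) / (2 * ((1024 : ℕ) : ℝ)) = 1 / 2048 := by norm_num
  have e2 : (1 : ℝ) / (12 * ((1024 : ℕ) : ℝ) ^ 2) = 1 / 12582912 := by norm_num
  rw [hlog, e1, e2] at h
  generalize ((harmonic 1024 : ℚ) : ℝ) = H at h hH
  push_cast at hH
  linarith

end Literature.Analysis.SpecialFunctions.Real
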